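import Summits.ABC.ABC.Theses.IneffectiveSubspace
import Summits.ABC.ABC.Theorems.IneffectiveSubspaceTowerFourSubLiouvilleStubFixedFormsRoth
import Summits.ABC.ABC.Theorems.IneffectiveSubspaceDepthCountedABCStubDictionary

/-!
# Stub `stub_fibreRoth` of line `Sketch` — crux `IneffectiveSubspace.DepthCountedABC` (stmt-ABC-14938)

THE ROTH STRATUM OF THE `K = 0` CORE.  The `K = 0` core of line `Sketch`
(`T₀ = S4SmallMemberABC ⟺ LW4`) asks for `c ≤ C(ε) · a · (S₄(b) S₄(c))^(1+ε)` on every abc triple,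
where `S₄(n) = ∏_{p ∣ n} p^⌈v_p(n)/4⌉ = ∏ p ∈ n.primeFactors, p ^ ((v_p(n)+3)/4)` is the level-4 radical.
Card `depth-grouped-four-logarithms` claims that every *fibre* of this statement is Roth's theorem, so
that the entire open content is uniformity.  This stub is that claim in arithmetic coordinates:

* (conjunct 1) on the quartic-twist fibres `b = vY⁴`, `c = wZ⁴` with BOUNDED sub-quartic layers
  `max v w ≤ H` the inequality `wZ⁴ ≤ C · a · (YZ)^(1+ε)` holds with `C = C(H, ε)` (ineffective);
* (conjunct 2) `Y ∣ S₄(vY⁴)` (so `YZ ∣ S₄(b) S₄(c)` and conjunct 1 implies `T₀` on these fibres).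

**Proof of conjunct 1.**  Fix `H, ε` and put `η := 2 − 2ε < 2`.  For each coefficient pair
`1 ≤ v, w ≤ H` the landed per-form Thue–Siegel–Roth inequality
(`TowerFourSubLiouville.fixedFormsRoth_pair`) gives a threshold beyond which `Z^η < |wZ⁴ − vY⁴|`
whenever `wZ⁴ ≠ vY⁴`; let `Z₁` be the maximum of these finitely many thresholds (`Finset.sup` over the
box).  Take `C := 2 + H(2H)^(1+ε) + H Z₁⁴`.  Given an abc triple `(a, vY⁴, wZ⁴)` with `max v w ≤ H`
(so `a, v, w, Y, Z ≥ 1`, `H ≥ 1`, `wZ⁴ − vY⁴ = a > 0`):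
if `Z < Z₁` then `wZ⁴ ≤ H Z₁⁴ ≤ H Z₁⁴ · a · (YZ)^(1+ε)`;
if `Z ≥ Z₁` then Roth gives `Z^η < a`, and either `vY⁴ < a`, whence `wZ⁴ = a + vY⁴ ≤ 2a ≤ 2a(YZ)^(1+ε)`,
or `a ≤ vY⁴`, whence `Z⁴ ≤ wZ⁴ ≤ 2vY⁴ ≤ 2H Y⁴ ≤ (2HY)⁴`, `Z ≤ 2HY`, `Z² ≤ 2H · YZ` and
`wZ⁴ ≤ H Z⁴ = H · Z^η · (Z²)^(1+ε) ≤ H · a · (2H · YZ)^(1+ε) = H(2H)^(1+ε) · a · (YZ)^(1+ε)`.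

**Proof of conjunct 2.**  Compare factorizations: `v_p(S₄(vY⁴)) = (v_p(v) + 4 v_p(Y) + 3)/4 ≥ v_p(Y)`
(`stubDictionary_factorization_S4`, `Nat.factorization_le_iff_dvd`).

Sources: skeleton `Cruxes/DepthCountedABC/Lines/Sketch.lean` of lead `prover-line-stmt-ABC-14938-0`
(stub `stub_fibreRoth`).  Ingredients: `Summit.ABC.ABC.Theorems.TowerFourSubLiouville.fixedFormsRoth_pair`
(landed in `Theorems/IneffectiveSubspaceTowerFourSubLiouvilleStubFixedFormsRoth.lean`; ultimately
`Literature.NumberTheory.DiophantineGeometry.roth_holds`, Roth's theorem, PROVED in the tree), the box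
maximum ADAPTED from `TowerFourSubLiouville.stub_fixedFormsRoth` (same file),
`Summit.ABC.ABC.Theorems.DepthCountedABC.stubDictionary_factorization_S4`
(`Theorems/IneffectiveSubspaceDepthCountedABCStubDictionary.lean`), and Mathlib (`Real.rpow_natCast`,
`Real.rpow_add`, `Real.rpow_mul`, `Real.rpow_le_rpow`, `Real.mul_rpow`, `Real.one_le_rpow`,
`Nat.pow_le_pow_iff_left`, `Nat.le_self_pow`, `Nat.factorization_mul`, `Nat.factorization_pow`,
`Nat.factorization_le_iff_dvd`).  No unproved facts.
Deliberately NOT here: any uniformity in `H` (that is the open core `T₀` itself), the fibres with three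
other logarithms fixed, and the converse bookkeeping `T₀ ⟹ conjunct 1` (immediate, not registered).
-/

-- `Summit.<Summit>.<Problem>` is the mandated summit-side namespace (CONVENTIONS §2); for the
-- single-conjunct summit `ABC` the two coincide, so the duplicate `ABC.ABC` is deliberate.
set_option linter.dupNamespace false

namespace Summit.ABC.ABC.Theorems.DepthCountedABC

open scoped BigOperators

/-- **Uniform Roth threshold over a finite box of binomial quartic forms.**  For every `H` and every
`η < 2` there is `Z₁` such that `Z^η < |wZ⁴ − vY⁴|` for all `1 ≤ v, w ≤ H`, all `Y` and all `Z ≥ Z₁`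
with `wZ⁴ ≠ vY⁴`: the maximum over the box of the per-form Thue–Siegel–Roth thresholds
`TowerFourSubLiouville.fixedFormsRoth_pair`. [cite: Roth1955] -/
theorem fibreRoth_box (H : ℕ) {η : ℝ} (hη2 : η < 2) :
    ∃ Z₁ : ℕ, ∀ v w Y Z : ℕ, Z₁ ≤ Z → 0 < v → 0 < w → v ≤ H → w ≤ H →
      w * Z ^ 4 ≠ v * Y ^ 4 → (Z : ℝ) ^ η < |((w * Z ^ 4 : ℕ) : ℝ) - ((v * Y ^ 4 : ℕ) : ℝ)| := by
  -- adapted from `TowerFourSubLiouville.stub_fixedFormsRoth`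
  -- (Theorems/IneffectiveSubspaceTowerFourSubLiouvilleStubFixedFormsRoth.lean)
  have hpair : ∀ v w : ℕ, ∃ Z₀ : ℕ, ∀ Y Z : ℕ, Z₀ ≤ Z → 0 < v → 0 < w →
      w * Z ^ 4 ≠ v * Y ^ 4 → (Z : ℝ) ^ η < |((w * Z ^ 4 : ℕ) : ℝ) - ((v * Y ^ 4 : ℕ) : ℝ)| := by
    intro v w
    rcases Nat.eq_zero_or_pos v with hv | hv
    · exact ⟨0, fun Y Z _ hv' _ _ => absurd hv' (by omega)⟩
    rcases Nat.eq_zero_or_pos w with hw | hw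
    · exact ⟨0, fun Y Z _ _ hw' _ => absurd hw' (by omega)⟩
    obtain ⟨Z₀, hZ₀⟩ := TowerFourSubLiouville.fixedFormsRoth_pair hη2 hv hw
    exact ⟨Z₀, fun Y Z hZ _ _ hne => hZ₀ Y Z hZ hne⟩
  choose f hf using hpair
  refine ⟨(Finset.range (H + 1) ×ˢ Finset.range (H + 1)).sup (fun q => f q.1 q.2), ?_⟩
  intro v w Y Z hZ hv hw hvH hwH hne
  have hmem : (v, w) ∈ Finset.range (H + 1) ×ˢ Finset.range (H + 1) := by
    rw [Finset.mem_product, Finset.mem_range, Finset.mem_range]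
    exact ⟨Nat.lt_succ_of_le hvH, Nat.lt_succ_of_le hwH⟩
  have hfle : f v w ≤ Z :=
    le_trans (Finset.le_sup (f := fun q : ℕ × ℕ => f q.1 q.2) hmem) hZ
  exact hf v w Y Z hfle hv hw hne

/-- **Conjunct 1: `T₀` on the quartic-twist fibres with bounded sub-quartic layers.**  For every `H`
and `ε > 0` there is `C = C(H, ε) > 0` with `wZ⁴ ≤ C · a · (YZ)^(1+ε)` for every abc triple
`(a, vY⁴, wZ⁴)` with `max v w ≤ H` (Roth with saving `η = 2 − 2ε`, uniform over the finite box;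
ineffective). [cite: Roth1955] -/
theorem fibreRoth_uniform (H : ℕ) (ε : ℝ) (hε : 0 < ε) :
    ∃ C : ℝ, 0 < C ∧ ∀ a v w Y Z : ℕ,
      Literature.NumberTheory.DiophantineGeometry.IsABCTriple a (v * Y ^ 4) (w * Z ^ 4) →
      max v w ≤ H → ((w * Z ^ 4 : ℕ) : ℝ) ≤ C * (a : ℝ) * ((Y * Z : ℕ) : ℝ) ^ (1 + ε) := by
  have hη2 : (2 : ℝ) - 2 * ε < 2 := by linarith
  obtain ⟨Z₁, hZ₁⟩ := fibreRoth_box H hη2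
  -- the three constants of the three cases, and their sum
  have hT2 : (0 : ℝ) ≤ (H : ℝ) * ((2 * H : ℕ) : ℝ) ^ (1 + ε) := by positivity
  have hT3 : (0 : ℝ) ≤ (H : ℝ) * (Z₁ : ℝ) ^ 4 := by positivity
  refine ⟨2 + (H : ℝ) * ((2 * H : ℕ) : ℝ) ^ (1 + ε) + (H : ℝ) * (Z₁ : ℝ) ^ 4, by positivity, ?_⟩
  intro a v w Y Z habc hmax
  obtain ⟨ha, hb, hsum, -⟩ := habc
  -- positivity of all the letters
  have hv : 0 < v := Nat.pos_of_ne_zero (fun h => by simp [h] at hb)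
  have hY : 0 < Y := Nat.pos_of_ne_zero (fun h => by simp [h] at hb)
  have hc : 0 < w * Z ^ 4 := by omega
  have hw : 0 < w := Nat.pos_of_ne_zero (fun h => by simp [h] at hc)
  have hZ : 0 < Z := Nat.pos_of_ne_zero (fun h => by simp [h] at hc)
  have hvH : v ≤ H := le_of_max_le_left hmax
  have hwH : w ≤ H := le_of_max_le_right hmax
  have haR : (1 : ℝ) ≤ a := by exact_mod_cast ha
  have hYZ : (1 : ℝ) ≤ ((Y * Z : ℕ) : ℝ) := by exact_mod_cast Nat.mul_pos hY hZ
  have hS : (1 : ℝ) ≤ ((Y * Z : ℕ) : ℝ) ^ (1 + ε) := Real.one_le_rpow hYZ (by linarith)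
  have haS : (1 : ℝ) ≤ (a : ℝ) * ((Y * Z : ℕ) : ℝ) ^ (1 + ε) := one_le_mul_of_one_le_of_one_le haR hS
  -- it suffices to bound `c` by `T · a · (YZ)^(1+ε)` for one of the three constants `T ≤ C`
  have finish : ∀ T : ℝ, T ≤ 2 + (H : ℝ) * ((2 * H : ℕ) : ℝ) ^ (1 + ε) + (H : ℝ) * (Z₁ : ℝ) ^ 4 →
      ((w * Z ^ 4 : ℕ) : ℝ) ≤ T * (a : ℝ) * ((Y * Z : ℕ) : ℝ) ^ (1 + ε) →
      ((w * Z ^ 4 : ℕ) : ℝ) ≤ (2 + (H : ℝ) * ((2 * H : ℕ) : ℝ) ^ (1 + ε) + (H : ℝ) * (Z₁ : ℝ) ^ 4) *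
        (a : ℝ) * ((Y * Z : ℕ) : ℝ) ^ (1 + ε) := by
    intro T hT h
    refine h.trans ?_
    rw [mul_assoc, mul_assoc]
    exact mul_le_mul_of_nonneg_right hT (by positivity)
  rcases Nat.lt_or_ge Z Z₁ with hZlt | hZge
  · -- CASE `Z < Z₁`: `c = wZ⁴ ≤ H Z₁⁴`
    refine finish ((H : ℝ) * (Z₁ : ℝ) ^ 4) (by linarith) ?_
    have h1 : ((w * Z ^ 4 : ℕ) : ℝ) ≤ (H : ℝ) * (Z₁ : ℝ) ^ 4 := by
      exact_mod_cast Nat.mul_le_mul hwH (Nat.pow_le_pow_left hZlt.le 4)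
    calc ((w * Z ^ 4 : ℕ) : ℝ) ≤ (H : ℝ) * (Z₁ : ℝ) ^ 4 * 1 := by rw [mul_one]; exact h1
      _ ≤ (H : ℝ) * (Z₁ : ℝ) ^ 4 * ((a : ℝ) * ((Y * Z : ℕ) : ℝ) ^ (1 + ε)) :=
          mul_le_mul_of_nonneg_left haS hT3
      _ = (H : ℝ) * (Z₁ : ℝ) ^ 4 * (a : ℝ) * ((Y * Z : ℕ) : ℝ) ^ (1 + ε) := by ring
  · -- CASE `Z ≥ Z₁`: Roth gives `Z^(2-2ε) < |wZ⁴ − vY⁴| = a`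
    have hne : w * Z ^ 4 ≠ v * Y ^ 4 := by omega
    have hroth := hZ₁ v w Y Z hZge hv hw hvH hwH hne
    have habs : |((w * Z ^ 4 : ℕ) : ℝ) - ((v * Y ^ 4 : ℕ) : ℝ)| = (a : ℝ) := by
      have hdiff : ((w * Z ^ 4 : ℕ) : ℝ) - ((v * Y ^ 4 : ℕ) : ℝ) = (a : ℝ) := by
        rw [sub_eq_iff_eq_add]
        exact_mod_cast (by omega : w * Z ^ 4 = a + v * Y ^ 4)
      rw [hdiff, abs_of_pos (by exact_mod_cast ha)]
    rw [habs] at hroth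
    rcases Nat.lt_or_ge (v * Y ^ 4) a with hlt | hle
    · -- sub-case `vY⁴ < a`: `c ≤ 2a`
      refine finish 2 (by linarith) ?_
      have h1 : ((w * Z ^ 4 : ℕ) : ℝ) ≤ 2 * (a : ℝ) := by
        exact_mod_cast (by omega : w * Z ^ 4 ≤ 2 * a)
      calc ((w * Z ^ 4 : ℕ) : ℝ) ≤ 2 * (a : ℝ) * 1 := by rw [mul_one]; exact h1
        _ ≤ 2 * (a : ℝ) * ((Y * Z : ℕ) : ℝ) ^ (1 + ε) :=
            mul_le_mul_of_nonneg_left hS (by positivity)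
    · -- sub-case `a ≤ vY⁴`: then `Z ≤ 2HY`
      refine finish ((H : ℝ) * ((2 * H : ℕ) : ℝ) ^ (1 + ε)) (by linarith) ?_
      have hZY : Z ≤ 2 * H * Y := by
        have h4 : Z ^ 4 ≤ (2 * H * Y) ^ 4 :=
          calc Z ^ 4 ≤ w * Z ^ 4 := Nat.le_mul_of_pos_left _ hw
            _ = a + v * Y ^ 4 := hsum.symm
            _ ≤ 2 * (v * Y ^ 4) := by omega
            _ ≤ 2 * (H * Y ^ 4) := Nat.mul_le_mul_left 2 (Nat.mul_le_mul_right _ hvH)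
            _ = (2 * H) * Y ^ 4 := by ring
            _ ≤ (2 * H) ^ 4 * Y ^ 4 := Nat.mul_le_mul_right _ (Nat.le_self_pow (by norm_num) _)
            _ = (2 * H * Y) ^ 4 := by ring
        exact (Nat.pow_le_pow_iff_left (by norm_num)).mp h4
      have hZr : (0 : ℝ) < Z := by exact_mod_cast hZ
      -- exponent bookkeeping: `Z⁴ = Z^(2-2ε) · (Z²)^(1+ε)`
      have hsplit : (Z : ℝ) ^ (2 - 2 * ε) * ((Z : ℝ) ^ 2) ^ (1 + ε) = (Z : ℝ) ^ 4 := by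
        rw [← Real.rpow_natCast (Z : ℝ) 2, ← Real.rpow_mul hZr.le, ← Real.rpow_add hZr,
          ← Real.rpow_natCast (Z : ℝ) 4]
        congr 1
        push_cast
        ring
      -- `Z² ≤ 2H · YZ`, raised to the power `1 + ε`
      have hZ2 : (Z : ℝ) ^ 2 ≤ ((2 * H : ℕ) : ℝ) * ((Y * Z : ℕ) : ℝ) := by
        have h2 : Z ^ 2 ≤ 2 * H * (Y * Z) :=
          calc Z ^ 2 = Z * Z := sq Z
            _ ≤ (2 * H * Y) * Z := Nat.mul_le_mul_right Z hZY
            _ = 2 * H * (Y * Z) := by ring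
        exact_mod_cast h2
      have hmr : (((2 * H : ℕ) : ℝ) * ((Y * Z : ℕ) : ℝ)) ^ (1 + ε) =
          ((2 * H : ℕ) : ℝ) ^ (1 + ε) * ((Y * Z : ℕ) : ℝ) ^ (1 + ε) :=
        Real.mul_rpow (by positivity) (by positivity)
      have hpow : ((Z : ℝ) ^ 2) ^ (1 + ε) ≤
          ((2 * H : ℕ) : ℝ) ^ (1 + ε) * ((Y * Z : ℕ) : ℝ) ^ (1 + ε) :=
        (Real.rpow_le_rpow (by positivity) hZ2 (by linarith)).trans_eq hmr
      calc ((w * Z ^ 4 : ℕ) : ℝ) ≤ (H : ℝ) * (Z : ℝ) ^ 4 := by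
            exact_mod_cast Nat.mul_le_mul_right _ hwH
        _ = (H : ℝ) * ((Z : ℝ) ^ (2 - 2 * ε) * ((Z : ℝ) ^ 2) ^ (1 + ε)) := by rw [hsplit]
        _ ≤ (H : ℝ) * ((a : ℝ) * (((2 * H : ℕ) : ℝ) ^ (1 + ε) * ((Y * Z : ℕ) : ℝ) ^ (1 + ε))) := by
            apply mul_le_mul_of_nonneg_left _ (by positivity)
            exact mul_le_mul hroth.le hpow (by positivity) (by positivity)
        _ = (H : ℝ) * ((2 * H : ℕ) : ℝ) ^ (1 + ε) * (a : ℝ) * ((Y * Z : ℕ) : ℝ) ^ (1 + ε) := by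
            ring

/-- **Conjunct 2: the layer `Y` divides the level-4 radical of `vY⁴`.**  For `v, Y ≥ 1`,
`Y ∣ S₄(vY⁴) = ∏_{p ∣ vY⁴} p^⌈v_p(vY⁴)/4⌉`, since `⌈(v_p(v) + 4 v_p(Y))/4⌉ ≥ v_p(Y)`. [folklore] -/
theorem fibreRoth_dvd_S4 (v Y : ℕ) (hv : 0 < v) (hY : 0 < Y) :
    Y ∣ ∏ p ∈ (v * Y ^ 4).primeFactors, p ^ (((v * Y ^ 4).factorization p + 3) / 4) := by
  have hS : (∏ p ∈ (v * Y ^ 4).primeFactors, p ^ (((v * Y ^ 4).factorization p + 3) / 4)) ≠ 0 :=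
    Finset.prod_ne_zero_iff.mpr fun p hp => pow_ne_zero _ (Nat.prime_of_mem_primeFactors hp).ne_zero
  rw [← Nat.factorization_le_iff_dvd hY.ne' hS, Finsupp.le_def]
  intro p
  rw [stubDictionary_factorization_S4, Nat.factorization_mul hv.ne' (pow_ne_zero 4 hY.ne'),
    Nat.factorization_pow]
  simp only [Finsupp.add_apply, Finsupp.smul_apply, smul_eq_mul]
  omega

/-- **`stub_fibreRoth`** (W5 of line `Sketch`, crux stmt-ABC-14938; the registered statement).  The Roth
stratum of the `K = 0` core `T₀ = S4SmallMemberABC`: (1) on the quartic-twist fibres `b = vY⁴`,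
`c = wZ⁴` with bounded sub-quartic layers `max v w ≤ H`, every abc triple satisfies
`c ≤ C(H, ε) · a · (YZ)^(1+ε)` (Thue–Siegel–Roth per form, maximum over the finite box; ineffective),
and (2) `Y ∣ S₄(vY⁴)`, so that `YZ ∣ S₄(b) S₄(c)`.  Hence every such fibre of `T₀` is a theorem and the
open content of the core is uniformity in `H`. [cite: Roth1955] -/
theorem stub_fibreRoth :
    (∀ H : ℕ, ∀ ε : ℝ, 0 < ε → ∃ C : ℝ, 0 < C ∧ ∀ a v w Y Z : ℕ,
      Literature.NumberTheory.DiophantineGeometry.IsABCTriple a (v * Y ^ 4) (w * Z ^ 4) → max v w ≤ H →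
      ((w * Z ^ 4 : ℕ) : ℝ) ≤ C * (a : ℝ) * ((Y * Z : ℕ) : ℝ) ^ (1 + ε)) ∧
    (∀ v Y : ℕ, 0 < v → 0 < Y →
      Y ∣ ∏ p ∈ (v * Y ^ 4).primeFactors, p ^ (((v * Y ^ 4).factorization p + 3) / 4)) :=
  ⟨fibreRoth_uniform, fibreRoth_dvd_S4⟩

end Summit.ABC.ABC.Theorems.DepthCountedABC
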